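import Summits.ResolutionOfSingularities.ResolutionOfSingularities.Theorems.WeightedInvariantHypersurfaceCentreAssemblyChartBridge
import Literature.AlgebraicGeometry.Hironaka2017.Lib.ReesAlgebraGlue
import Mathlib.AlgebraicGeometry.Noetherian
import HarnessLib

/-!
# Door assembly H2c″, stub [S3] — gluing the canonical centre from the pointwise presentations along the maximum locus

Route `ResolutionOfSingularities/WeightedInvariant`, crux `Theses.WeightedInvariant.HypersurfaceCentreConstruction`
(stmt-ResolutionOfSingularities-19897), door line `local-engine`, registered stub [S3] `stub_exists_isCanonicalCentre`
(holder res-L1-w43-stub-9 = res-D-brk-1; this file = the GLUING half, written by res-type-089 on the holder's terms).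

`exists_isCanonicalCentre_of_presentations`: on a smooth quasi-compact `Y → Spec k`, if the maximum locus `M = maxLocus ι X`
is closed ([S1]) and EVERY point `y ∈ M` carries the output of the ∀-model open-presentation clause read on `Y` — an affine
`U₀ ∋ y` with `X(U₀) = (F)`, `h` with `y ∈ D(h)`, a positively weighted system `U : Fin N → Γ(Y, U₀)` with STRATUM EXACTNESS
on `D(h)` («all `Uᵢ` vanish at `y'` iff `y' ∈ M`») and the PRESENTATION of the model filtration `J(Γ(Y,U₀)_{𝔮_{y'}}, F/1)`
by `(U, W)` at the points of `M ∩ D(h)` (the same data tuple as `exists_chart_of_presentation`, p504102, minus the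
independence at `y`, which only [S4] needs) — then a canonical centre `R` (`IsCanonicalCentre ι J X R`) EXISTS.
Proof: `M` is compact, finitely many `D(h_y)` cover it; the weighted monomial ideals of the charts have the same germ
ideals at common points (on `M`: both are `J(𝒪_{Y,y'}, f_{y'})` by the stalk dictionary p503684; off `M`: both are unit by
stratum exactness) and unit germs off `M`; `Lib/ReesAlgebraGlue.exists_reesAlgebraData_of_basicOpenCharts` (p505324) glues
them to a Rees algebra with exactly these stalks, and the three `IsCanonicalCentre` fields are read off. Def-free helper
(`--supports stmt-ResolutionOfSingularities-19897`); no claim about Hironaka's problem; AI-written, weaker than expert review.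
-/

noncomputable section

set_option linter.dupNamespace false -- mandated namespace of this single-conjunct summit

open CategoryTheory AlgebraicGeometry TopologicalSpace IsLocalRing
open Literature.AlgebraicGeometry.Resolution
open Literature.AlgebraicGeometry.Hironaka2017.S02Preliminaries
open Summit.ResolutionOfSingularities.ResolutionOfSingularities.Theorems

namespace Summit.ResolutionOfSingularities.ResolutionOfSingularities.Cruxes.HypersurfaceCentreConstruction.LocalEngine

variable (ι : (R : Type) → [CommRing R] → R → Ordinal.{0}) (J : (R : Type) → [CommRing R] → R → ℕ → Ideal R)

/-- In positive degree a weighted monomial ideal lies in any ideal containing all the parameters (every monomial of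
positive weighted degree involves some parameter). [cite: Wlodarczyk2022, 2.1.10] -/
theorem weightedMonomialIdeal_le_of_forall_mem_of_pos {A : Type*} [CommRing A] {m : ℕ} (u : Fin m → A)
    (w : Fin m → ℕ) {P : Ideal A} (hu : ∀ i, u i ∈ P) {n : ℕ} (hn : 0 < n) : weightedMonomialIdeal u w n ≤ P := by
  rw [weightedMonomialIdeal, Ideal.span_le]
  rintro _ ⟨α, hα, rfl⟩
  obtain ⟨i, hi⟩ : ∃ i, 0 < α i := by
    by_contra hcon
    push Not at hcon
    have : ∑ j, w j * α j = 0 := Finset.sum_eq_zero fun j _ => by rw [Nat.le_zero.mp (hcon j), mul_zero]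
    omega
  rw [SetLike.mem_coe, ← Finset.mul_prod_erase Finset.univ (fun j => u j ^ α j) (Finset.mem_univ i)]
  exact P.mul_mem_right _ (P.pow_mem_of_mem (hu i) _ hi)

/-- A smooth quasi-compact scheme over a field is Noetherian. [folklore] -/
theorem isNoetherian_of_smooth_quasiCompact {k : Type} [Field k] {Y : Scheme.{0}} (f : Y ⟶ Spec (.of k)) [Smooth f]
    [QuasiCompact f] : IsNoetherian Y := by
  haveI : IsLocallyNoetherian Y := LocallyOfFiniteType.isLocallyNoetherian f
  haveI : CompactSpace Y := QuasiCompact.compactSpace_of_compactSpace f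
  exact {}

/-- **[S3], gluing half: a canonical centre exists as soon as every point of the (closed) maximum locus carries a
stratum-exact presentation chart.** See the module docstring; the data tuple per point `y ∈ maxLocus ι X` is that of
`exists_chart_of_presentation` without the independence clause. [cite: Wlodarczyk2022, §2.2 and 2.1.10] -/
theorem exists_isCanonicalCentre_of_presentations {k : Type} [Field k] {Y : Scheme.{0}} (f : Y ⟶ Spec (.of k))
    [Smooth f] [QuasiCompact f] (hJ : JIsoInvariant J) (hJu : JUnitInvariant J) (X : Y.IdealSheafData)
    (hM : IsClosed (maxLocus ι X))
    (hpres : ∀ y ∈ maxLocus ι X, ∃ (U₀ : Y.affineOpens) (_ : y ∈ (U₀ : Y.Opens)) (F : Γ(Y, U₀))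
      (_ : X.ideal U₀ = Ideal.span {F}) (h : Γ(Y, U₀)) (_ : y ∈ Y.basicOpen h) (N : ℕ) (U : Fin N → Γ(Y, U₀))
      (W : Fin N → ℕ), (∀ i, 0 < W i) ∧
      (∀ (y' : Y) (hy' : y' ∈ (U₀ : Y.Opens)), y' ∈ Y.basicOpen h →
        ((∀ i, (Y.presheaf.germ (U₀ : Y.Opens) y' hy').hom (U i) ∈ maximalIdeal (Y.presheaf.stalk y')) ↔
          y' ∈ maxLocus ι X)) ∧
      (∀ (y' : Y) (hy' : y' ∈ (U₀ : Y.Opens)), y' ∈ Y.basicOpen h → y' ∈ maxLocus ι X → ∀ m : ℕ,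
        J (Localization.AtPrime (U₀.2.primeIdealOf ⟨y', hy'⟩).asIdeal)
            (algebraMap Γ(Y, U₀) (Localization.AtPrime (U₀.2.primeIdealOf ⟨y', hy'⟩).asIdeal) F) m =
          (weightedMonomialIdeal U W m).map
            (algebraMap Γ(Y, U₀) (Localization.AtPrime (U₀.2.primeIdealOf ⟨y', hy'⟩).asIdeal)))) :
    ∃ R : ReesAlgebraData Y, IsCanonicalCentre ι J X R := by
  haveI : IsNoetherian Y := isNoetherian_of_smooth_quasiCompact f
  -- choose the presentation data at every point of the maximum locus
  choose U₀ _hyU F hF hh hyh N U W hW hstrat hpr using hpres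
  -- finitely many of the basic opens `D(h_y)` cover the compact maximum locus
  have hMc : IsCompact (maxLocus ι X) := hM.isCompact
  obtain ⟨t, ht⟩ := hMc.elim_finite_subcover (fun z : maxLocus ι X => (Y.basicOpen (hh z.1 z.2) : Set Y))
    (fun z => (Y.basicOpen (hh z.1 z.2)).isOpen) fun y hy => Set.mem_iUnion.mpr ⟨⟨y, hy⟩, hyh y hy⟩
  have hcov : ∀ y ∈ maxLocus ι X, ∃ z ∈ t, y ∈ Y.basicOpen (hh z.1 z.2) := fun y hy => by
    simpa only [Set.mem_iUnion, exists_prop, SetLike.mem_coe] using ht hy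
  -- germ ideals of the weighted monomial ideals at the points of a chart: the canonical filtration on `M` …
  have hgermM : ∀ (z : maxLocus ι X) (y' : Y) (hy' : y' ∈ Y.basicOpen (hh z.1 z.2)), y' ∈ maxLocus ι X →
      ∀ n : ℕ, (weightedMonomialIdeal (U z.1 z.2) (W z.1 z.2) n).map
          (Y.presheaf.germ (U₀ z.1 z.2 : Y.Opens) y' (Y.basicOpen_le _ hy')).hom =
        J (Y.presheaf.stalk y') (localGenerator X y') n := fun z y' hy' hy'M n =>
    (J_localGenerator_eq_map_germ_of_presentation J (hy := Y.basicOpen_le _ hy') f hJ hJu X (hF z.1 z.2)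
      (hpr z.1 z.2 y' (Y.basicOpen_le _ hy') hy' hy'M n)).symm
  -- … and the unit ideal off `M` (stratum exactness: some parameter is a unit there)
  have hgermN : ∀ (z : maxLocus ι X) (y' : Y) (hy' : y' ∈ Y.basicOpen (hh z.1 z.2)), y' ∉ maxLocus ι X →
      ∀ n : ℕ, (weightedMonomialIdeal (U z.1 z.2) (W z.1 z.2) n).map
          (Y.presheaf.germ (U₀ z.1 z.2 : Y.Opens) y' (Y.basicOpen_le _ hy')).hom = ⊤ := by
    intro z y' hy' hy'M n
    have hy'U : y' ∈ (U₀ z.1 z.2 : Y.Opens) := Y.basicOpen_le _ hy'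
    obtain ⟨i, hi⟩ : ∃ i, (Y.presheaf.germ (U₀ z.1 z.2 : Y.Opens) y' hy'U).hom (U z.1 z.2 i) ∉
        maximalIdeal (Y.presheaf.stalk y') := by
      by_contra hall
      push Not at hall
      exact hy'M ((hstrat z.1 z.2 y' hy'U hy').mp hall)
    rw [weightedMonomialIdeal_map]
    exact weightedMonomialIdeal_eq_top_of_isUnit _ _ (hW z.1 z.2 i) (IsLocalRing.notMem_maximalIdeal.mp hi) n
  -- glue (Lib/ReesAlgebraGlue, basic-open chart form)
  obtain ⟨R, hR, hoff, hsub⟩ := exists_reesAlgebraData_of_basicOpenCharts (S := Y) (κ := t)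
    (fun z => U₀ z.1.1 z.1.2) (fun z => hh z.1.1 z.1.2)
    (fun z n => weightedMonomialIdeal (U z.1.1 z.1.2) (W z.1.1 z.1.2) n)
    (fun z => weightedMonomialIdeal_zero _ _) (fun z m n => weightedMonomialIdeal_mul_le _ _ m n)
    (fun j z y' hj hz n => by
      by_cases hy'M : y' ∈ maxLocus ι X
      · rw [hgermM j.1 y' hj hy'M n, hgermM z.1 y' hz hy'M n]
      · rw [hgermN j.1 y' hj hy'M n, hgermN z.1 y' hz hy'M n]) hM
    (fun z y' hz hy'M n => hgermN z.1 y' hz hy'M n)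
  refine ⟨R, ⟨?_, ?_, hoff⟩⟩
  · -- support `= M`: `⊆` from the unit stalks off `M`, `⊇` since the parameters vanish on `M` and the weights are positive
    refine reesAlgebraData_support_eq_of_stalkIdeal R hsub fun y hy n hn => ?_
    obtain ⟨z, hz, hyz⟩ := hcov y hy
    have hyU : y ∈ (U₀ z.1 z.2 : Y.Opens) := Y.basicOpen_le _ hyz
    rw [hR ⟨z, hz⟩ y hyz n, weightedMonomialIdeal_map]
    exact fun htop => (maximalIdeal.isMaximal (Y.presheaf.stalk y)).ne_top (top_le_iff.mp (htop ▸
      weightedMonomialIdeal_le_of_forall_mem_of_pos _ _ ((hstrat z.1 z.2 y hyU hyz).mpr hy) hn))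
  · -- on `M` the stalks are the canonical filtration
    intro y hy n
    obtain ⟨z, hz, hyz⟩ := hcov y hy
    rw [hR ⟨z, hz⟩ y hyz n, hgermM z y hyz hy n]

end Summit.ResolutionOfSingularities.ResolutionOfSingularities.Cruxes.HypersurfaceCentreConstruction.LocalEngine

end
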